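import Literature.NumberTheory.LFunctions.Zhang2022.EllRegimeLambdaBox
import Mathlib.NumberTheory.LSeries.Nonvanishing
import Mathlib.NumberTheory.Harmonic.EulerMascheroni
import HarnessLib

/-!
# Zhang (2022) in the `ℓ`-regime: the dipole parameter is PINNED under (A) — the row «`EllLambdaPinned`»
# (`λ(χ) → 0⁻`), its quantitative form, the typed reading in terms of `EllLambdaBox` / `EllLambdaOneSided`,
# the bridges to the `Λ`-box dictionary rows for EVERY `Λ > 0`, and the PROVED «Route 1» algebra of the
# truncated `ν = 1 ∗ χ` model (cell `landau-siegel`, family B-ell; ls-theory ruling (δ2) 2026-08-26T22:47:47Z,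
# typing GO ls-Bell-plan g1 23:53:26Z (6); this leaf imports ls-Bell-typer-1's `EllRegimeLambdaBox`)

Topic `Literature/NumberTheory/LFunctions/Zhang2022` (Landau–Siegel audit tree; verdict-neutral).
Y. Zhang, *Discrete mean estimates and the Landau–Siegel zero*, arXiv:2211.02515v1 [Zhang2022LandauSiegel] —
an unrefereed manuscript under adjudication. **WHAT THIS IS NOT: not a claim about Theorems 1–2 of
arXiv:2211.02515, about Landau–Siegel zeros, or about Parity. Every `def … : Prop` below is a NAMED STATEMENT
(a derivation row of the cell, status «derivation-desk, unreviewed»), asserted by no one; the `theorem`s are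
bookkeeping implications between rows and elementary facts about a finite model sum.**

WHY THIS FILE.  `EllRegimeLambdaBox` (ls-Bell-typer-1) separated the dipole parameter
`λ(χ) = lambdaDipole χ = Re L″(1,χ)/(2·Re L′(1,χ)·log D)` of dict-1's first-order term `G₀ + λ·G₁` from its BOX:
`EllLambdaBox η C₀` (under (A), eventually `−½ − η ≤ λ(χ) ≤ C₀/log D`; Hadamard + explicit Deuring–Heilbronn +
explicit zero counting; derivation) and `EllLambdaOneSided c` (`λ(χ) ≤ −c/log D`; HEUR for `c = 1.7171`).  The
cell's theory desk then ruled (ls-theory g1, ruling (δ)/(δ′) of 2026-08-26T22:47:47Z, item (δ2), label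
«DERIVATION-desk»; folded in B-ell/deriv-1/D-ELL-1c.md v0.1 §0.4 and B-ell/KILL-draft.md v0.7 §1) that under the
QUANTIFIED assumption (A) the parameter is PINNED: writing `N(s) = ζ(s)L(s,χ) = Σ ν(n)n^{−s}`, `ν = 1 ∗ χ ≥ 0`,
(Route 1) the `L(1,χ)/u` term of `N(1+u)` is invisible for `𝓛^{−1000} ≤ u ≤ 𝓛^{−3}` (`𝓛 = log D`), so
`L′(1,χ) = Σ_{n≤X} ν(n)/n + o(1)` (`X = D·𝓛^{4046}`) and `γL′ + L″/2 = −Σ_{n≤X} ν(n)log n/n + o(1)`, i.e.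
`λ = −(γ + ⟨log n⟩_ν)/log D + o(1/log D)` with `⟨log n⟩_ν` the `ν(n)/n`-weighted mean of `log n` over `n ≤ X`;
and the (A)-SPARSITY of `ν` (hyperbola method + Pólya–Vinogradov: `Σ_{n≤x} ν(n) ≤ x𝓛^{−2022} + O(√(Dx)𝓛)`, then
`k`-fold products of split primes at every scale `D^ε`, `ε ≥ ε₀ ≍ loglog𝓛/log𝓛`) gives `⟨log n⟩_ν = o(log D)`,
whence `λ → 0⁻`, `|λ| ≲ c·loglog𝓛/log𝓛`; (Route 2, consistency) Hadamard: `λ·log D = Σ_{ρ≠β₁} Re(1−ρ)⁻¹ −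
½log D + O(1)`, and in the (A)-world the low zeros of `N` have full density near `σ = ½`, so the sum is
`(½ + O(1/log𝓛))·log D`.  Consequence for the B-ell word: the first-order dictionary is PARAMETER-FREE (the box
`Box((A))` contracts onto the undressed model point `(λ, c′_ar) = (0⁻, 0)`), and the `λ`-column of test #1 is a
robustness display.  This file TYPES that ruling and PROVES what is bookkeeping:

* rows `EllLambdaPinned` (qualitative: under (A), for every `ε > 0` eventually `−ε ≤ λ(χ)`, and eventually
  `λ(χ) < 0`) and `EllLambdaPinnedRate c` (eventually `−c·logloglog D/loglog D ≤ λ(χ) < 0`); the identification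
  row `EllLambdaModelId X e` (Route 1's first step, = LIST U items (U1)+(U2) of D-ELL-1c §7: under (A),
  `|λ(χ) − λ_X(χ)| ≤ e(D)` with `λ_X` the truncated-model value below) — all three «derivation-desk», no proof here;
* PROVED typed reading (ls-Bell-plan g1 23:53:26Z (5)): `EllLambdaPinned → EllLambdaOneSided 0 ∧ ∀ ε > 0,
  EllLambdaBox (ε − ½) 0` (`ellLambdaPinned_reading`), and the converse up to the strict sign
  (`ellLambdaPinned_iff`); `EllLambdaPinnedRate c → EllLambdaPinned` (`ellLambdaPinned_of_rate`:
  `logloglog D/loglog D → 0`, PROVED);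
* PROVED bridges for EVERY `Λ > 0` (the box row only reached `Λ ≥ ½ + η`): `EllLambdaPinned.abs_le`
  (eventually `|λ(χ)| ≤ Λ`), `EllLambdaPinned.box` (`EllLambdaBox (Λ − ½) 0`), and through ls-Bell-typer-1's
  bridges `ellDictFirstOrderLam_of_true_of_pinned`, `ellDictFirstOrderProfile_of_true_of_pinned`,
  `ellCSDictLam_of_true_of_pinned`, `theorem1_of_ellDictProfileTrue_of_pinned` (TRUE-`λ` rows + pinning ⇒ the
  `Λ`-box rows consumed by the endgames, any `Λ > 0`);
* the truncated MODEL of Route 1, with PROVED elementary facts: `nuCoeff χ n = Re (ζ ∗ χ)(n) ≥ 0` for a real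
  character (Mathlib's `DirichletCharacter.zetaMul_nonneg`), `nuCoeff χ 1 = 1`; `modelLPrime χ X = Σ_{n≤X} ν(n)/n ≥ 1`,
  `modelLogMoment χ X = Σ_{n≤X} ν(n)log n/n ∈ [0, log X · modelLPrime]`;
  `modelLambda χ X = −(γ + modelLogMoment/modelLPrime)/log D` satisfies `−(γ + log X)/log D ≤ λ_X ≤ −γ/log D < 0`
  (`γ` = Euler–Mascheroni, `> ½` in Mathlib) — so Route 1's SIGN is unconditional arithmetic of the model and its
  formula even gives `λ(χ) ≤ −c/log D` for every `c < γ` once the identification holds with error `o(1/log D)`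
  (`ellLambdaOneSided_of_modelId`, PROVED), while the PINNING is exactly the moment bound
  `⟨log n⟩_ν ≤ η·log D` displayed as a hypothesis (`neg_le_lambdaDipole_of_model`, PROVED; no row minted for it).

Deliberately NOT here: any proof of `EllLambdaPinned` / `EllLambdaPinnedRate` / `EllLambdaModelId` (their inputs —
the `u`-window matching of `N(1+u)`, the (A)-sparsity count, Pólya–Vinogradov — are the theory desk's, status
«derivation-desk, unreviewed»; ls-theory's KNIFE-EDGES v2.5 records «λ → 0⁻ under (A), rate loglog𝓛/log𝓛, two
desk routes»); any numerical value of record; any claim that a row holds.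

## References
* Y. Zhang, arXiv:2211.02515v1 (2022): §2 Assumption (A), (2.6) (`P = exp 𝓛⁹`), (2.13), (2.32); §3 (3.1) p.7
  (`ζ(s)L(s,χ) = Σ ν(n)n^{−s}`, `0 ≤ |υ(n)| ≤ ν(n) ≤ τ₂(n)`); §4 Lemma 4.7, (4.10); §5 Lemmas 5.4–5.7, and the
  PROOF of Lemma 5.7 p.11 («the left side is, by moving the line of integration to the left appropriately and
  applying (A), equal to `L′(1,χ) + o(1)`» = Route 1's identification of `L′(1,χ)` with the truncated `ν`-sum);
  §8 Lemmas 8.2–8.4, (8.23). Locators read on the materialised pages (paper:arxiv-2211.02515 p0007, p0011).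
  [cite: Zhang2022LandauSiegel, §2 Assumption (A); §3 (3.1); §5 Lemmas 5.4–5.7; §8 Lemmas 8.2–8.4]
* Mathlib, `Mathlib.NumberTheory.LSeries.Nonvanishing` (`DirichletCharacter.zetaMul_nonneg`: the coefficients of
  `ζ·L(·,χ)` are non-negative for `χ² = 1`) and `Mathlib.NumberTheory.Harmonic.EulerMascheroni`
  (`½ < γ < ⅔`). [folklore]

«The programme SEARCHES and TYPES; no claim about Landau–Siegel zeros, Theorems 1–2 of arXiv:2211.02515
or a repaired Margin232 until a kernel theorem says so.»
-/

noncomputable section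

open Complex Real Filter Topology
open scoped ComplexOrder

namespace Literature.NumberTheory.LFunctions.Zhang2022

namespace EllRegime

open EllScales Repair Skeleton

/-! ## §1 The rows: `λ(χ)` pinned under (A) -/

section Rows

/-- **Row «EllLambdaPinned»** (ls-theory ruling (δ2), DERIVATION-desk, unreviewed): under (A), the dipole
parameter `λ(χ) = L″(1,χ)/(2L′(1,χ)log D)` tends to `0` FROM BELOW along real primitive characters — for every
`ε > 0`, eventually `−ε ≤ λ(χ)`; and eventually `λ(χ) < 0`.  Route 1: `λ = −(γ + ⟨log n⟩_ν)/log D + o(1/log D)`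
with `ν = 1 ∗ χ ≥ 0` and `⟨log n⟩_ν = o(log D)` by the (A)-sparsity of `ν`; Route 2: Hadamard + full zero density
near `σ = ½` in the (A)-world.  Supersedes, for the (A)-world, the `O(1)` box of `EllLambdaBox` (which stays the
unconditional-shape statement).  A DEFINITION; asserted by no one. [cite: Zhang2022LandauSiegel, §2 Assumption (A); §5 Lemmas 5.4–5.7; §8 Lemmas 8.2–8.4] -/
def EllLambdaPinned : Prop :=
  (∀ ε : ℝ, 0 < ε → ForAllLarge fun D _ χ => AssumptionA D χ → -ε ≤ lambdaDipole χ) ∧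
    ForAllLarge fun D _ χ => AssumptionA D χ → lambdaDipole χ < 0

/-- **Row «EllLambdaPinnedRate (c)»** (the quantitative form of (δ2): `|λ| ≲ c·loglog𝓛/log𝓛`, `𝓛 = log D`):
under (A), eventually `−c·log log log D/log log D ≤ λ(χ) < 0`.  A DEFINITION; asserted for no `c`.
[cite: Zhang2022LandauSiegel, §2 Assumption (A); §5 Lemmas 5.4–5.7] -/
def EllLambdaPinnedRate (c : ℝ) : Prop :=
  ForAllLarge fun D _ χ => AssumptionA D χ →
    -(c * Real.log (Real.log (Real.log D)) / Real.log (Real.log D)) ≤ lambdaDipole χ ∧ lambdaDipole χ < 0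

/-- **Typed reading of the pinning in the vocabulary of `EllRegimeLambdaBox`** (ls-Bell-plan g1 23:53:26Z (5)):
`EllLambdaPinned` gives `EllLambdaOneSided 0` (eventually `λ(χ) ≤ 0`) and, for every `ε > 0`, the box
`EllLambdaBox (ε − ½) 0` (eventually `−ε ≤ λ(χ) ≤ 0`). PROVED. [cite: Zhang2022LandauSiegel, §5 Lemma 5.7] -/
theorem ellLambdaPinned_reading (h : EllLambdaPinned) :
    EllLambdaOneSided 0 ∧ ∀ ε : ℝ, 0 < ε → EllLambdaBox (ε - 1 / 2) 0 := by
  refine ⟨h.2.mono fun D _ χ _ _ hlt hA => ?_, fun ε hε => ?_⟩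
  · have := hlt hA
    rw [neg_zero, zero_div]
    exact this.le
  · exact ((h.1 ε hε).and h.2).mono fun D _ χ _ _ hall hA =>
      ⟨by linarith [hall.1 hA], by rw [zero_div]; exact (hall.2 hA).le⟩

/-- The pinning row, split into the family of boxes `EllLambdaBox (ε − ½) 0` and the strict sign. PROVED.
[cite: Zhang2022LandauSiegel, §5 Lemma 5.7] -/
theorem ellLambdaPinned_iff :
    EllLambdaPinned ↔ (∀ ε : ℝ, 0 < ε → EllLambdaBox (ε - 1 / 2) 0) ∧
      ForAllLarge fun D _ χ => AssumptionA D χ → lambdaDipole χ < 0 := by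
  constructor
  · exact fun h => ⟨(ellLambdaPinned_reading h).2, h.2⟩
  · rintro ⟨hbox, hneg⟩
    refine ⟨fun ε hε => (hbox ε hε).mono fun D _ χ _ _ hb hA => ?_, hneg⟩
    have := (hb hA).1
    linarith

/-- A positive one-sided bound plus the vanishing half give the pinning: `EllLambdaOneSided c` with `c > 0` and
`∀ ε > 0`, eventually `−ε ≤ λ(χ)`, imply `EllLambdaPinned`. PROVED. [cite: Zhang2022LandauSiegel, §5 Lemma 5.7] -/
theorem ellLambdaPinned_of_oneSided {c : ℝ} (hc : 0 < c) (hone : EllLambdaOneSided c)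
    (hvan : ∀ ε : ℝ, 0 < ε → ForAllLarge fun D _ χ => AssumptionA D χ → -ε ≤ lambdaDipole χ) :
    EllLambdaPinned := by
  refine ⟨hvan, ?_⟩
  have h2 : ForAllLarge fun D _ _ => 2 ≤ D := ForAllLarge.of_le 2 fun D _ _ hD _ _ => hD
  refine (hone.and h2).mono fun D _ χ _ _ hall hA => ?_
  have hD : (1 : ℝ) < D := by exact_mod_cast lt_of_lt_of_le one_lt_two hall.2
  have hlog : 0 < Real.log (D : ℝ) := Real.log_pos hD
  have hlt : -c / Real.log (D : ℝ) < 0 := div_neg_of_neg_of_pos (neg_neg_of_pos hc) hlog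
  exact lt_of_le_of_lt (hall.1 hA) hlt

/-- **Pinning ⇒ `|λ(χ)| ≤ Λ` eventually, for EVERY `Λ > 0`** (the box row only gave `Λ ≥ ½ + η`). PROVED.
[cite: Zhang2022LandauSiegel, §5 Lemma 5.7] -/
theorem EllLambdaPinned.abs_le (h : EllLambdaPinned) {Λ : ℝ} (hΛ : 0 < Λ) :
    ForAllLarge fun D _ χ => AssumptionA D χ → |lambdaDipole χ| ≤ Λ :=
  ((h.1 Λ hΛ).and h.2).mono fun _ _ _ _ _ hall hA =>
    _root_.abs_le.mpr ⟨hall.1 hA, le_trans (hall.2 hA).le hΛ.le⟩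

/-- **Pinning ⇒ the box `EllLambdaBox (Λ − ½) 0`** for every `Λ > 0` (so ls-Bell-typer-1's bridges apply with
`½ + (Λ − ½) = Λ`). PROVED. [cite: Zhang2022LandauSiegel, §5 Lemma 5.7] -/
theorem EllLambdaPinned.box (h : EllLambdaPinned) {Λ : ℝ} (hΛ : 0 < Λ) : EllLambdaBox (Λ - 1 / 2) 0 :=
  (ellLambdaPinned_reading h).2 Λ hΛ

end Rows

/-! ## §2 The quantitative row implies the qualitative one (`logloglog D/loglog D → 0`, PROVED) -/

section Rate

/-- `log(log(log D))/log(log D) → 0` along `D → ∞` in `ℕ` (the rate in ls-theory's (δ2) «`|λ| ≲ c·loglog𝓛/log𝓛`»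
tends to `0`). [cite: Zhang2022LandauSiegel, §2 Assumption (A); §5 Lemma 5.7] -/
theorem tendsto_logloglog_div_loglog :
    Tendsto (fun D : ℕ => Real.log (Real.log (Real.log D)) / Real.log (Real.log D)) atTop (𝓝 0) := by
  have h1 : Tendsto (fun x : ℝ => Real.log x ^ 1 / (1 * x + 0)) atTop (𝓝 0) :=
    Real.tendsto_pow_log_div_mul_add_atTop 1 0 1 one_ne_zero
  have h2 : Tendsto (fun D : ℕ => Real.log (Real.log (D : ℝ))) atTop atTop :=
    Real.tendsto_log_atTop.comp (Real.tendsto_log_atTop.comp tendsto_natCast_atTop_atTop)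
  have := h1.comp h2
  refine this.congr fun D => ?_
  simp [Function.comp]

/-- **`EllLambdaPinnedRate c ⇒ EllLambdaPinned`** (any `c`: the rate `logloglog D/loglog D → 0`). PROVED.
[cite: Zhang2022LandauSiegel, §5 Lemma 5.7] -/
theorem ellLambdaPinned_of_rate {c : ℝ} (h : EllLambdaPinnedRate c) : EllLambdaPinned := by
  refine ⟨fun ε hε => ?_, h.mono fun D _ χ _ _ hall hA => (hall hA).2⟩
  -- eventually `c · logloglog D / loglog D ≤ ε`
  have hev : ∀ᶠ D : ℕ in atTop, c * (Real.log (Real.log (Real.log D)) / Real.log (Real.log D)) ≤ ε := by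
    have ht : Tendsto (fun D : ℕ => c * (Real.log (Real.log (Real.log D)) / Real.log (Real.log D))) atTop
        (𝓝 (c * 0)) := tendsto_logloglog_div_loglog.const_mul c
    rw [mul_zero] at ht
    exact (ht.eventually (gt_mem_nhds hε)).mono fun D hD => hD.le
  obtain ⟨D₁, hD₁⟩ := Filter.eventually_atTop.mp hev
  have hlarge : ForAllLarge fun D _ _ =>
      c * (Real.log (Real.log (Real.log D)) / Real.log (Real.log D)) ≤ ε :=
    ForAllLarge.of_le D₁ fun D _ _ hD _ _ => hD₁ D hD
  refine (h.and hlarge).mono fun D _ χ _ _ hall hA => ?_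
  have h1 := (hall.1 hA).1
  have h2 := hall.2
  rw [mul_div_assoc] at h1
  linarith

end Rate

/-! ## §3 Bridges to the `Λ`-box dictionary rows for EVERY `Λ > 0` (through ls-Bell-typer-1's bridges) -/

section Bridges

/-- **TRUE-`λ` dictionary + pinning ⇒ E-022's `Λ`-form, any `Λ > 0`.** [cite: Zhang2022LandauSiegel, §8 (8.23); §5 Lemma 5.7] -/
theorem ellDictFirstOrderLam_of_true_of_pinned {c' : ℝ} {Fam : (S : Scales) → Finset (Chr S)}
    {Adm : Theta → Prop} {G₀ G₁ : Theta → ℝ → ℝ × ℝ × ℝ} {K : Theta → ℝ → ℝ} {A₀ Λ : ℝ}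
    (h : EllDictFirstOrderTrue c' Fam Adm G₀ G₁ K A₀) (hpin : EllLambdaPinned) (hΛ : 0 < Λ) :
    EllDictFirstOrderLam c' Fam Adm G₀ G₁ Λ K A₀ :=
  ellDictFirstOrderLam_of_true h (hpin.box hΛ) (by linarith) hΛ

/-- **One profile, any `Λ > 0`.** [cite: Zhang2022LandauSiegel, §8 (8.23); §5 Lemma 5.7] -/
theorem ellDictFirstOrderProfile_of_true_of_pinned {c' : ℝ} {Fam : (S : Scales) → Finset (Chr S)}
    {g g' : ℝ → ℂ} {G₀ G₁ K A₀ Λ : ℝ} (h : EllDictFirstOrderProfileTrue c' Fam g g' G₀ G₁ K A₀)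
    (hpin : EllLambdaPinned) (hΛ : 0 < Λ) : EllDictFirstOrderProfile c' Fam g g' G₀ G₁ Λ K A₀ :=
  ellDictFirstOrderProfile_of_true h (hpin.box hΛ) (by linarith) hΛ

/-- **Tie/CS sheet, any `Λ > 0`.** [cite: Zhang2022LandauSiegel, §2 (2.17), (2.32)–(2.33); §5 Lemma 5.7] -/
theorem ellCSDictLam_of_true_of_pinned {c' : ℝ} {Fam : (S : Scales) → Finset (Chr S)} {Adm : Theta → Prop}
    {G₀ G₁ : Theta → ℝ → ℝ × ℝ × ℝ} {GJ₀ GJ₁ : Theta → ℝ → ℝ} {GX₀ GX₁ : Theta → ℝ → ℂ}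
    {δf : Theta → ℝ → ℝ → ℝ} {K : Theta → ℝ → ℝ} {A₀ Λ : ℝ}
    (h : EllCSDictTrue c' Fam Adm G₀ G₁ GJ₀ GJ₁ GX₀ GX₁ δf K A₀) (hpin : EllLambdaPinned) (hΛ : 0 < Λ) :
    EllCSDictLam c' Fam Adm G₀ G₁ GJ₀ GJ₁ GX₀ GX₁ Λ δf K A₀ :=
  ellCSDictLam_of_true h (hpin.box hΛ) (by linarith) hΛ

/-- **Theorem 1 from the TRUE-`λ` one-profile dictionary + pinning (any `Λ > 0`) + ell-E13 + E-020 + `hneg`.**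
[cite: Zhang2022LandauSiegel, §1 Theorem 1; §2 p. 6] -/
theorem theorem1_of_ellDictProfileTrue_of_pinned {c' : ℝ} {Fam : (S : Scales) → Finset (Chr S)}
    {g g' : ℝ → ℂ} {G₀ G₁ K A₀ Λ A₁ cZ A₂ A : ℝ} (h : EllDictFirstOrderProfileTrue c' Fam g g' G₀ G₁ K A₀)
    (hpin : EllLambdaPinned) (hΛ : 0 < Λ) (h23 : Lemma23FixedA c' Fam A₁) (hZ : EllZeroModelFixedA Fam cZ A₂)
    (h0 : A₀ ≤ A) (h1 : A₁ ≤ A) (h2 : A₂ ≤ A)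
    (hneg : ∃ D₁ : ℕ, ∀ S : Scales, D₁ ≤ S.D → S.IsEllRegimeP A → ∀ lam : ℝ, |lam| ≤ Λ →
      mainTermFormEll S.ellP (rescale S.shrink g) (rescale' S.shrink g') + (G₀ + lam * G₁) / A
        + K / A ^ 2 < 0) :
    Theorem1 :=
  theorem1_of_ellDictProfileTrue h (hpin.box hΛ) (by linarith) hΛ h23 hZ h0 h1 h2 hneg

end Bridges

/-! ## §4 Route 1's truncated model `ν = 1 ∗ χ`: the finite sums and their PROVED elementary algebra -/

section Model

variable {D : ℕ}

/-- **`ν(n) = (1 ∗ χ)(n) = Σ_{d ∣ n} χ(d)`** — the `n`-th coefficient of `N(s) = ζ(s)L(s,χ)` (the manuscript's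
`ν` of §3: `ζ(s)L(s,χ) = Σ ν(n)n^{−s}`), as a real number (Mathlib: `DirichletCharacter.zetaMul χ = ζ * χ`; for a
real character its values are non-negative reals). [cite: Zhang2022LandauSiegel, §3 (3.1) p.7] -/
def nuCoeff (χ : DirichletCharacter ℂ D) (n : ℕ) : ℝ := (χ.zetaMul n).re

/-- `ν ≥ 0` for a real character — the manuscript's (3.1) `|υ(n)| ≤ ν(n) ≤ τ₂(n)` (left half), here from
Mathlib's `DirichletCharacter.zetaMul_nonneg`. [cite: Zhang2022LandauSiegel, §3 (3.1) p.7] -/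
theorem nuCoeff_nonneg {χ : DirichletCharacter ℂ D} (hχ : χ ^ 2 = 1) (n : ℕ) : 0 ≤ nuCoeff χ n :=
  (Complex.nonneg_iff.mp (DirichletCharacter.zetaMul_nonneg hχ n)).1

/-- `ν(1) = 1` (the manuscript: «`ν(n) = 1` if `n ∣ D`», proof of Lemma 5.7, at `n = 1`). [cite: Zhang2022LandauSiegel, §5 Lemma 5.7 (proof) p.11] -/
theorem nuCoeff_one (χ : DirichletCharacter ℂ D) : nuCoeff χ 1 = 1 := by
  simp [nuCoeff, (DirichletCharacter.isMultiplicative_zetaMul χ).map_one]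

/-- **Model for `L′(1,χ)` under (A)** (Route 1): `L′_X := Σ_{1 ≤ n ≤ X} ν(n)/n` — the manuscript's own
identification in the proof of Lemma 5.7: under (A), `L′(1,χ) + o(1) = Σ_n ν(n)n^{−1}g(D⁴/n)`.
[cite: Zhang2022LandauSiegel, §5 Lemma 5.7 (proof) p.11] -/
def modelLPrime (χ : DirichletCharacter ℂ D) (X : ℕ) : ℝ := ∑ n ∈ Finset.Icc 1 X, nuCoeff χ n / n

/-- **Model for `−(γL′ + L″/2)(1,χ)` under (A)** (Route 1): `S_X := Σ_{1 ≤ n ≤ X} ν(n)·log n/n`.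
[cite: Zhang2022LandauSiegel, §2 Assumption (A); §5 Lemma 5.7] -/
def modelLogMoment (χ : DirichletCharacter ℂ D) (X : ℕ) : ℝ :=
  ∑ n ∈ Finset.Icc 1 X, nuCoeff χ n * Real.log n / n

/-- **The truncated-model value of the dipole parameter** `λ_X := −(γ + S_X/L′_X)/log D`
(`S_X/L′_X = ⟨log n⟩_ν`, the `ν(n)/n`-weighted mean of `log n` over `n ≤ X`). [cite: Zhang2022LandauSiegel, §5 Lemma 5.7; §8 Lemmas 8.2–8.4] -/
def modelLambda (χ : DirichletCharacter ℂ D) (X : ℕ) : ℝ :=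
  -(Real.eulerMascheroniConstant + modelLogMoment χ X / modelLPrime χ X) / Real.log D

/-- `L′_X ≥ ν(1) = 1` (the manuscript's `≫ Σ_{n∣D} 1/n` step of Lemma 5.7, kept to the `n = 1` term).
[cite: Zhang2022LandauSiegel, §5 Lemma 5.7 (proof) p.11] -/
theorem one_le_modelLPrime {χ : DirichletCharacter ℂ D} (hχ : χ ^ 2 = 1) {X : ℕ} (hX : 1 ≤ X) :
    1 ≤ modelLPrime χ X := by
  unfold modelLPrime
  have hmem : 1 ∈ Finset.Icc 1 X := Finset.mem_Icc.mpr ⟨le_rfl, hX⟩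
  have hle := Finset.single_le_sum (f := fun n : ℕ => nuCoeff χ n / n)
    (fun n _ => div_nonneg (nuCoeff_nonneg hχ n) (Nat.cast_nonneg n)) hmem
  simpa [nuCoeff_one] using hle

/-- `0 < L′_X`. [cite: Zhang2022LandauSiegel, §5 Lemma 5.7 (proof) p.11] -/
theorem modelLPrime_pos {χ : DirichletCharacter ℂ D} (hχ : χ ^ 2 = 1) {X : ℕ} (hX : 1 ≤ X) :
    0 < modelLPrime χ X :=
  lt_of_lt_of_le one_pos (one_le_modelLPrime hχ hX)

/-- `S_X ≥ 0` (`ν ≥ 0`, (3.1)). [cite: Zhang2022LandauSiegel, §3 (3.1) p.7] -/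
theorem modelLogMoment_nonneg {χ : DirichletCharacter ℂ D} (hχ : χ ^ 2 = 1) (X : ℕ) :
    0 ≤ modelLogMoment χ X :=
  Finset.sum_nonneg fun n _ =>
    div_nonneg (mul_nonneg (nuCoeff_nonneg hχ n) (Real.log_natCast_nonneg n)) (Nat.cast_nonneg n)

/-- `S_X ≤ log X · L′_X` (every `log n ≤ log X` on the range; `ν ≥ 0` by (3.1)). [cite: Zhang2022LandauSiegel, §3 (3.1) p.7] -/
theorem modelLogMoment_le {χ : DirichletCharacter ℂ D} (hχ : χ ^ 2 = 1) (X : ℕ) :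
    modelLogMoment χ X ≤ Real.log X * modelLPrime χ X := by
  unfold modelLogMoment modelLPrime
  rw [Finset.mul_sum]
  refine Finset.sum_le_sum fun n hn => ?_
  obtain ⟨h1, h2⟩ := Finset.mem_Icc.mp hn
  have hn0 : (0 : ℝ) < n := by exact_mod_cast h1
  have hlog : Real.log n ≤ Real.log X := Real.log_le_log hn0 (by exact_mod_cast h2)
  have hν := nuCoeff_nonneg hχ n
  have e : nuCoeff χ n * Real.log n / n = nuCoeff χ n / n * Real.log n := by ring
  rw [e, mul_comm (Real.log (X : ℝ))]
  exact mul_le_mul_of_nonneg_left hlog (div_nonneg hν hn0.le)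

/-- **`λ_X ≤ −γ/log D`** (`D ≥ 2`, `X ≥ 1`): the model value is negative with an explicit margin — Route 1's
SIGN is arithmetic (`ν ≥ 0` (3.1), `ν(1) = 1`). [cite: Zhang2022LandauSiegel, §3 (3.1) p.7; §5 Lemma 5.7 (proof) p.11] -/
theorem modelLambda_le {χ : DirichletCharacter ℂ D} (hχ : χ ^ 2 = 1) {X : ℕ} (hX : 1 ≤ X)
    (hD : 1 < (D : ℝ)) : modelLambda χ X ≤ -Real.eulerMascheroniConstant / Real.log D := by
  unfold modelLambda
  have hlog : 0 < Real.log (D : ℝ) := Real.log_pos hD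
  have hq : 0 ≤ modelLogMoment χ X / modelLPrime χ X :=
    div_nonneg (modelLogMoment_nonneg hχ X) (modelLPrime_pos hχ hX).le
  rw [div_le_div_iff_of_pos_right hlog]
  linarith

/-- **`λ_X < 0`.** [cite: Zhang2022LandauSiegel, §3 (3.1) p.7; §5 Lemma 5.7 (proof) p.11] -/
theorem modelLambda_neg {χ : DirichletCharacter ℂ D} (hχ : χ ^ 2 = 1) {X : ℕ} (hX : 1 ≤ X)
    (hD : 1 < (D : ℝ)) : modelLambda χ X < 0 := by
  have hγ : 0 < Real.eulerMascheroniConstant := lt_trans (by norm_num) Real.one_half_lt_eulerMascheroniConstant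
  have hlog : 0 < Real.log (D : ℝ) := Real.log_pos hD
  exact lt_of_le_of_lt (modelLambda_le hχ hX hD) (div_neg_of_neg_of_pos (neg_neg_of_pos hγ) hlog)

/-- **`−(γ + log X)/log D ≤ λ_X`** (the trivial lower bound; the PINNING `λ_X ≥ −(γ/log D + η)` is the moment
bound `S_X ≤ η·log D·L′_X`, see `neg_le_modelLambda_of_moment`). [cite: Zhang2022LandauSiegel, §3 (3.1) p.7; §5 Lemma 5.7 (proof) p.11] -/
theorem neg_le_modelLambda {χ : DirichletCharacter ℂ D} (hχ : χ ^ 2 = 1) {X : ℕ} (hX : 1 ≤ X)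
    (hD : 1 < (D : ℝ)) :
    -(Real.eulerMascheroniConstant + Real.log X) / Real.log D ≤ modelLambda χ X := by
  unfold modelLambda
  have hlog : 0 < Real.log (D : ℝ) := Real.log_pos hD
  have hL := modelLPrime_pos hχ hX
  have hq : modelLogMoment χ X / modelLPrime χ X ≤ Real.log X := by
    rw [div_le_iff₀ hL]
    exact modelLogMoment_le hχ X
  rw [div_le_div_iff_of_pos_right hlog]
  linarith

/-- **The pinning as a moment bound**: if `S_X ≤ η·log D·L′_X` (Route 1's sparsity conclusion
`⟨log n⟩_ν ≤ η·log D`, DISPLAYED as a hypothesis) then `−γ/log D − η ≤ λ_X`. PROVED. [cite: Zhang2022LandauSiegel, §2 Assumption (A); §5 Lemma 5.7] -/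
theorem neg_le_modelLambda_of_moment {χ : DirichletCharacter ℂ D} (hχ : χ ^ 2 = 1) {X : ℕ} (hX : 1 ≤ X)
    (hD : 1 < (D : ℝ)) {η : ℝ} (hmom : modelLogMoment χ X ≤ η * Real.log D * modelLPrime χ X) :
    -Real.eulerMascheroniConstant / Real.log D - η ≤ modelLambda χ X := by
  unfold modelLambda
  have hlog : 0 < Real.log (D : ℝ) := Real.log_pos hD
  have hL := modelLPrime_pos hχ hX
  have hq : modelLogMoment χ X / modelLPrime χ X ≤ η * Real.log D := by
    rw [div_le_iff₀ hL]
    exact hmom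
  have : -Real.eulerMascheroniConstant / Real.log D - η =
      -(Real.eulerMascheroniConstant + η * Real.log D) / Real.log D := by
    field_simp
    ring
  rw [this, div_le_div_iff_of_pos_right hlog]
  linarith

end Model

/-! ## §5 The identification row (Route 1's first step = LIST U (U1)+(U2)) and what it buys, PROVED -/

section Identification

/-- **Row «EllLambdaModelId (X, e)»** (theory (δ2) Route 1, first step; D-ELL-1c §7 LIST U items (U1) `(1−β₁)L_M
→ 0` and (U2) «Taylor data of `L(s,χ)` at `1` = those of the truncated `ν`-series»): under (A), for every real
primitive `χ` to every large modulus `D`, `|λ(χ) − λ_{X(D)}(χ)| ≤ e(D)` — matching `N(1+u) = ζ(1+u)L(1+u,χ)`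
against `Σ_{n≤X} ν(n)n^{−1−u}` on the window `𝓛^{−1000} ≤ u ≤ 𝓛^{−3}`, where the `L(1,χ)/u` term is `≤ 𝓛^{−1022}`
and the tail `n > X = D𝓛^{4046}` is `≤ 𝓛^{−2019}` by (A)-sparsity + Pólya–Vinogradov.  Status «derivation-desk,
unreviewed».  A DEFINITION; asserted for no `(X, e)`. [cite: Zhang2022LandauSiegel, §2 Assumption (A); §5 Lemmas 5.4–5.7] -/
def EllLambdaModelId (X : ℕ → ℕ) (e : ℕ → ℝ) : Prop :=
  ForAllLarge fun D _ χ => AssumptionA D χ → |lambdaDipole χ - modelLambda χ (X D)| ≤ e D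

/-- At one `(D, χ)`: identification with error `e` ⇒ `λ(χ) ≤ −γ/log D + e`. PROVED. [cite: Zhang2022LandauSiegel, §5 Lemma 5.7] -/
theorem lambdaDipole_le_of_model {D : ℕ} [NeZero D] {χ : DirichletCharacter ℂ D} (hχ : χ ^ 2 = 1) {X : ℕ}
    (hX : 1 ≤ X) (hD : 1 < (D : ℝ)) {e : ℝ} (hid : |lambdaDipole χ - modelLambda χ X| ≤ e) :
    lambdaDipole χ ≤ -Real.eulerMascheroniConstant / Real.log D + e := by
  have h1 := (abs_le.mp hid).2
  have h2 := modelLambda_le hχ hX hD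
  linarith

/-- At one `(D, χ)`: identification with error `e` and the moment bound `S_X ≤ η·log D·L′_X` ⇒
`−γ/log D − η − e ≤ λ(χ)`. PROVED. [cite: Zhang2022LandauSiegel, §5 Lemma 5.7] -/
theorem neg_le_lambdaDipole_of_model {D : ℕ} [NeZero D] {χ : DirichletCharacter ℂ D} (hχ : χ ^ 2 = 1)
    {X : ℕ} (hX : 1 ≤ X) (hD : 1 < (D : ℝ)) {e η : ℝ} (hid : |lambdaDipole χ - modelLambda χ X| ≤ e)
    (hmom : modelLogMoment χ X ≤ η * Real.log D * modelLPrime χ X) :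
    -Real.eulerMascheroniConstant / Real.log D - η - e ≤ lambdaDipole χ := by
  have h1 := (abs_le.mp hid).1
  have h2 := neg_le_modelLambda_of_moment hχ hX hD hmom
  linarith

/-- **The SIGN half of (δ2) from the identification row alone**: `EllLambdaModelId X e` with `X ≥ 1` and
eventually `e(D) ≤ (γ − c)/log D` gives `EllLambdaOneSided c` — in particular for every `c < γ` once
`e(D)·log D → 0`.  (Route 1: `λ·log D ≤ −γ + o(1)`; no sparsity needed for the sign.) PROVED.
[cite: Zhang2022LandauSiegel, §2 Assumption (A); §5 Lemma 5.7] -/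
theorem ellLambdaOneSided_of_modelId {X : ℕ → ℕ} {e : ℕ → ℝ} {c : ℝ} (hX : ∀ D, 1 ≤ X D)
    (hid : EllLambdaModelId X e)
    (he : ∃ D₁ : ℕ, ∀ D : ℕ, D₁ ≤ D → e D ≤ (Real.eulerMascheroniConstant - c) / Real.log D) :
    EllLambdaOneSided c := by
  obtain ⟨D₁, hD₁⟩ := he
  have hlarge : ForAllLarge fun D _ _ =>
      e D ≤ (Real.eulerMascheroniConstant - c) / Real.log D ∧ 2 ≤ D :=
    ForAllLarge.of_le (max D₁ 2) fun D _ _ hD _ _ =>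
      ⟨hD₁ D (le_trans (le_max_left _ _) hD), le_trans (le_max_right _ _) hD⟩
  refine (hid.and hlarge).mono fun D _ χ hq _ hall hA => ?_
  obtain ⟨hid', he', h2⟩ := hall
  have hχ : χ ^ 2 = 1 := MulChar.isQuadratic_iff_sq_eq_one.mp hq
  have hD : (1 : ℝ) < D := by exact_mod_cast lt_of_lt_of_le one_lt_two h2
  have hlog : 0 < Real.log (D : ℝ) := Real.log_pos hD
  have h1 := lambdaDipole_le_of_model hχ (hX D) hD (hid' hA)
  have : -Real.eulerMascheroniConstant / Real.log D + (Real.eulerMascheroniConstant - c) / Real.log D =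
      -c / Real.log D := by
    field_simp
    ring
  linarith [this]

end Identification

end EllRegime

end Literature.NumberTheory.LFunctions.Zhang2022

end
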